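import Mathlib
import HarnessLib
import Literature.MathematicalPhysics.QuantumFieldTheory.Balaban1983to89.T4AdjointCovarianceUnitary
import Summits.Ventures.LatticeQCDFlow.Exactness.KernelCouplingGaugeEquivariance

/-!
# `SU(N)` stout / residual layers for every `N`: `U ↦ exp(Z) U` lands in `SU(N)` and is gauge equivariant whenever the exponent transforms in the adjoint

HONEST FRAMING: exact (Metropolis-corrected) sampling algorithms for lattice gauge theory;
figures of merit are autocorrelation/cost numbers at stated couplings and volumes; no
continuum-physics claim.

Venture `LatticeQCDFlow` (cell pub-lqcd), topic `Exactness`; FANOUT row 10 (`eng-equiv`, engine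
`latflow.equiv`, module `equiv/residual.py`: "stout / stout-defect / plaquette-potential layers"
`U_μ(x) ↦ exp(Σ_j ρ_j P(Ω_j)) U_μ(x)` on a masked set of links, general `SU(N)`; the same layers
in `latflow.flows_jax.layers` / `residual_flow`).  NEW WORK of the cell over
`KernelCouplingGaugeEquivariance.isGaugeEquivariant_mulLeft_of_conj_covariant` (any group:
adjoint-covariant left factors give equivariant layers), the tree's `WilsonFlow` vocabulary
(`suProj` = traceless anti-Hermitian projection `P`, `plaquetteLoopSum` = `Ω_{x,μ}`, with
`suProj_unitary_conj`, `plaquetteLoopSum_gaugeTransform`, `conjTranspose_suProj`,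
`trace_suProj`), the Bałaban lane's `exp_mem_specialUnitaryGroup_of_mem_lieSU` (`exp 𝔰𝔲(n) ⊆
SU(n)`, via the tree's `det_exp_eq_exp_trace`) and Mathlib's `Matrix.exp_conj`; nothing is cited
as a fact; no number; no definition is introduced.  The tree had this for `SU(2)` only
(`SU2MaskedKickEquivariance`, `SU2StapleFieldCovariance`, closed-form exponential); here `N` is
arbitrary.  Printed counterparts, NAMED ONLY: Morningstar–Peardon 2004 (stout smearing),
Lüscher 2010 §2 (the Wilson flow as an infinitesimal stout step), Abbott et al. arXiv:2305.02402
§3 (residual flows), Kanwar et al. 2020 / Boyda et al. 2021 (gauge-equivariant layers).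

## Content (`n : ℕ`, `SU(n) = Matrix.specialUnitaryGroup (Fin n) ℂ`; any `d`, `L`, mask `p`)

* `exp_mem_specialUnitaryGroup_of_star_eq_neg` — `exp Z ∈ SU(n)` for `star Z = −Z`,
  `tr Z = 0`; `smul_suProj_mem` — `(ρ : ℝ) • suProj W` is such a `Z` for every matrix `W`
  (so is `−ρ • suProj W`);
* `exp_conj_of_mem_specialUnitaryGroup` — `exp(g Z g⋆) = g (exp Z) g⋆` for `g ∈ SU(n)`;
* **`isGaugeEquivariant_expLayer`** — for ANY exponent field `Z(V, e) ∈ 𝔰𝔲(n)` that transforms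
  in the adjoint at the source of each active link, `Z(V^g, e) = g(x) Z(V, e) g(x)⋆`, the layer
  `V e ↦ exp(Z(V,e)) · V e` (active), `V e` (frozen) is `IsGaugeEquivariant` on
  `GaugeConfig d L SU(n)`;
* `smul_suProj_loopSum_gaugeTransform` — the stout exponent `ρ(V,e) • suProj(Ω_{x,μ}(V))` with a
  gauge-INVARIANT real coefficient `ρ(V, e)` (a constant, or a function of frozen plaquette
  traces) transforms in the adjoint; hence **`isGaugeEquivariant_sunStoutLayer`**: the masked
  `SU(n)` stout layer `V(x,μ) ↦ exp(ρ(V,(x,μ)) • P(Ω_{x,μ}(V))) V(x,μ)` is `IsGaugeEquivariant`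
  for every `n`, `d`, `L`, mask and invariant coefficient field (the sign convention of the
  engine, `exp(−ρ P(Ω))`, is the case `ρ ↦ −ρ`).

NOT here: bijectivity (`|ρ|` small, row 14's `SU2ResidualLayer` contraction argument) and the
Jacobian of the layer; multi-loop exponents `Σ_j ρ_j P(Ω_j)` (covered by
`isGaugeEquivariant_expLayer` once each `Ω_j` is shown adjoint-covariant, as `plaquetteLoopSum`
is); any number.
-/

noncomputable section

namespace Summit.Ventures.LatticeQCDFlow.Exactness

open Matrix
open Literature.MathematicalPhysics.QuantumFieldTheory
open Literature.MathematicalPhysics.QuantumFieldTheory.Balaban1983to89.T4AdjointCovarianceUnitary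
  (exp_mem_specialUnitaryGroup_of_mem_lieSU mem_lieSU_iff)

variable {d L n : ℕ}

/-! ## The exponential of a traceless anti-Hermitian matrix is special unitary; conjugation -/

/-- `exp Z ∈ SU(n)` for `Z` anti-Hermitian (`star Z = −Z`) and traceless (the tree's
`exp_mem_specialUnitaryGroup_of_mem_lieSU`: unitary by `exp_mem_unitary_of_mem_skewAdjoint`,
`det exp Z = exp tr Z = 1`). -/
theorem exp_mem_specialUnitaryGroup_of_star_eq_neg {Z : Matrix (Fin n) (Fin n) ℂ} (h1 : star Z = -Z)
    (h2 : Z.trace = 0) : NormedSpace.exp Z ∈ Matrix.specialUnitaryGroup (Fin n) ℂ :=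
  exp_mem_specialUnitaryGroup_of_mem_lieSU (mem_lieSU_iff.mpr ⟨h1, h2⟩)

/-- `ρ • P(W)` is anti-Hermitian and traceless for every matrix `W` and real `ρ`. -/
theorem smul_suProj_mem (ρ : ℝ) (W : Matrix (Fin n) (Fin n) ℂ) :
    star ((ρ : ℂ) • suProj W) = -((ρ : ℂ) • suProj W) ∧ ((ρ : ℂ) • suProj W).trace = 0 := by
  refine ⟨?_, ?_⟩
  · rw [star_smul, star_eq_conjTranspose, conjTranspose_suProj, Complex.star_def, Complex.conj_ofReal,
      smul_neg]
  · rw [trace_smul, trace_suProj, smul_zero]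

/-- `exp (ρ • P(W)) ∈ SU(n)`. -/
theorem exp_smul_suProj_mem (ρ : ℝ) (W : Matrix (Fin n) (Fin n) ℂ) :
    NormedSpace.exp ((ρ : ℂ) • suProj W) ∈ Matrix.specialUnitaryGroup (Fin n) ℂ :=
  exp_mem_specialUnitaryGroup_of_star_eq_neg (smul_suProj_mem ρ W).1 (smul_suProj_mem ρ W).2

/-- **`exp` commutes with special-unitary conjugation**: `exp(g Z g⋆) = g (exp Z) g⋆` for
`g ∈ SU(n)` (Mathlib `Matrix.exp_conj`, `g⋆ = g⁻¹`). -/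
theorem exp_conj_of_mem_specialUnitaryGroup {g : Matrix (Fin n) (Fin n) ℂ}
    (hg : g ∈ Matrix.specialUnitaryGroup (Fin n) ℂ) (Z : Matrix (Fin n) (Fin n) ℂ) :
    NormedSpace.exp (g * Z * star g) = g * NormedSpace.exp Z * star g := by
  have hgu : g ∈ Matrix.unitaryGroup (Fin n) ℂ := (Matrix.mem_specialUnitaryGroup_iff.mp hg).1
  have h1 : star g * g = 1 := Matrix.mem_unitaryGroup_iff'.mp hgu
  have hinv : g⁻¹ = star g := Matrix.inv_eq_left_inv h1
  have hunit : IsUnit g := (Matrix.isUnit_iff_isUnit_det g).mpr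
    (by rw [(Matrix.mem_specialUnitaryGroup_iff.mp hg).2]; exact isUnit_one)
  rw [← hinv]
  exact Matrix.exp_conj g Z hunit

/-! ## Exponential layers with adjoint-covariant exponents are gauge equivariant -/

/-- **Exponential (residual / stout-type) layers are gauge equivariant, every `n`.**  Let
`Z(V, e) ∈ 𝔰𝔲(n)` be an exponent field which at every active link `e = (x, μ)` transforms in
the adjoint at `x`: `Z(V^g, e) = g(x) Z(V, e) g(x)⋆`.  Then the layer
`V e ↦ exp(Z(V,e)) · V e` on active links, identity on frozen links, is `IsGaugeEquivariant`. -/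
theorem isGaugeEquivariant_expLayer (p : Edge d L → Prop) [DecidablePred p]
    (Z : GaugeConfig d L (Matrix.specialUnitaryGroup (Fin n) ℂ) → Edge d L → Matrix (Fin n) (Fin n) ℂ)
    (hZ : ∀ V e, star (Z V e) = -Z V e ∧ (Z V e).trace = 0)
    (hcov : ∀ (g : Site d L → Matrix.specialUnitaryGroup (Fin n) ℂ)
      (V : GaugeConfig d L (Matrix.specialUnitaryGroup (Fin n) ℂ)) (e : Edge d L), p e →
        Z (gaugeTransform g V) e =
          ((g e.1 : Matrix.specialUnitaryGroup (Fin n) ℂ) : Matrix (Fin n) (Fin n) ℂ) * Z V e *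
            star ((g e.1 : Matrix.specialUnitaryGroup (Fin n) ℂ) : Matrix (Fin n) (Fin n) ℂ)) :
    IsGaugeEquivariant (fun (V : GaugeConfig d L (Matrix.specialUnitaryGroup (Fin n) ℂ)) (e : Edge d L) =>
      if p e then
        (⟨NormedSpace.exp (Z V e), exp_mem_specialUnitaryGroup_of_star_eq_neg (hZ V e).1 (hZ V e).2⟩ :
          Matrix.specialUnitaryGroup (Fin n) ℂ) * V e
      else V e) := by
  refine isGaugeEquivariant_mulLeft_of_conj_covariant p
    (fun V e => (⟨NormedSpace.exp (Z V e), exp_mem_specialUnitaryGroup_of_star_eq_neg (hZ V e).1 (hZ V e).2⟩ :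
      Matrix.specialUnitaryGroup (Fin n) ℂ)) fun g V e he => ?_
  apply Subtype.ext
  change NormedSpace.exp (Z (gaugeTransform g V) e) =
    ((g e.1 : Matrix.specialUnitaryGroup (Fin n) ℂ) : Matrix (Fin n) (Fin n) ℂ) * NormedSpace.exp (Z V e) *
      star ((g e.1 : Matrix.specialUnitaryGroup (Fin n) ℂ) : Matrix (Fin n) (Fin n) ℂ)
  rw [hcov g V e he, exp_conj_of_mem_specialUnitaryGroup (g e.1).2]

/-! ## The stout exponent `ρ • P(Ω_{x,μ})` transforms in the adjoint -/

/-- **The stout exponent transforms in the adjoint**: with a gauge-invariant real coefficient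
field `ρ(V, e)` (at active links), `ρ(V^g,e) • P(Ω_{x,μ}(V^g)) = g(x) (ρ(V,e) • P(Ω_{x,μ}(V))) g(x)⋆`
(`plaquetteLoopSum_gaugeTransform`, `suProj_unitary_conj`). -/
theorem smul_suProj_loopSum_gaugeTransform (p : Edge d L → Prop)
    (ρ : GaugeConfig d L (Matrix.specialUnitaryGroup (Fin n) ℂ) → Edge d L → ℝ)
    (hρ : ∀ (g : Site d L → Matrix.specialUnitaryGroup (Fin n) ℂ)
      (V : GaugeConfig d L (Matrix.specialUnitaryGroup (Fin n) ℂ)) (e : Edge d L), p e →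
        ρ (gaugeTransform g V) e = ρ V e)
    (g : Site d L → Matrix.specialUnitaryGroup (Fin n) ℂ)
    (V : GaugeConfig d L (Matrix.specialUnitaryGroup (Fin n) ℂ)) (e : Edge d L) (he : p e) :
    (ρ (gaugeTransform g V) e : ℂ) • suProj (plaquetteLoopSum (gaugeTransform g V) e.1 e.2) =
      ((g e.1 : Matrix.specialUnitaryGroup (Fin n) ℂ) : Matrix (Fin n) (Fin n) ℂ) *
        ((ρ V e : ℂ) • suProj (plaquetteLoopSum V e.1 e.2)) *
          star ((g e.1 : Matrix.specialUnitaryGroup (Fin n) ℂ) : Matrix (Fin n) (Fin n) ℂ) := by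
  have hg : ((g e.1 : Matrix.specialUnitaryGroup (Fin n) ℂ) : Matrix (Fin n) (Fin n) ℂ) ∈
      Matrix.unitaryGroup (Fin n) ℂ := (g e.1).2.1
  rw [hρ g V e he, plaquetteLoopSum_gaugeTransform, ← star_eq_conjTranspose, suProj_unitary_conj hg,
    Matrix.mul_smul, Matrix.smul_mul]

/-- **The masked `SU(n)` stout layer is gauge equivariant — every `n`, `d`, `L`, mask, and every
gauge-invariant coefficient field `ρ`**: `V(x,μ) ↦ exp(ρ(V,(x,μ)) • P(Ω_{x,μ}(V))) · V(x,μ)` on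
active links (the engine's `exp(−ρ P(Ω))` is `ρ ↦ −ρ`), identity on frozen links. -/
theorem isGaugeEquivariant_sunStoutLayer (p : Edge d L → Prop) [DecidablePred p]
    (ρ : GaugeConfig d L (Matrix.specialUnitaryGroup (Fin n) ℂ) → Edge d L → ℝ)
    (hρ : ∀ (g : Site d L → Matrix.specialUnitaryGroup (Fin n) ℂ)
      (V : GaugeConfig d L (Matrix.specialUnitaryGroup (Fin n) ℂ)) (e : Edge d L), p e →
        ρ (gaugeTransform g V) e = ρ V e) :
    IsGaugeEquivariant (fun (V : GaugeConfig d L (Matrix.specialUnitaryGroup (Fin n) ℂ)) (e : Edge d L) =>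
      if p e then
        (⟨NormedSpace.exp ((ρ V e : ℂ) • suProj (plaquetteLoopSum V e.1 e.2)),
            exp_smul_suProj_mem (ρ V e) (plaquetteLoopSum V e.1 e.2)⟩ :
          Matrix.specialUnitaryGroup (Fin n) ℂ) * V e
      else V e) :=
  isGaugeEquivariant_expLayer p (fun V e => (ρ V e : ℂ) • suProj (plaquetteLoopSum V e.1 e.2))
    (fun V e => smul_suProj_mem (ρ V e) (plaquetteLoopSum V e.1 e.2))
    (fun g V e he => smul_suProj_loopSum_gaugeTransform p ρ hρ g V e he)

end Summit.Ventures.LatticeQCDFlow.Exactness
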